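import Mathlib
import HarnessLib

/-!
# Triple integrals in cylindrical and spherical coordinates are iterated integrals over a box

Topic `Literature/MeasureTheory/Integral`; namespace `Literature.MeasureTheory.Integral`.  The three-dimensional
companion of `PolarSectorIntegral.lean` (polar rectangles and disks in the plane), which is NOT imported: this file
depends on Mathlib and HarnessLib only.

THE STATEMENTS.  Hurley, *Intermediate Calculus* (1980).  Sect. 5.7 (cylindrical coordinates `x = r cos θ`,
`y = r sin θ`, `z = z`), Theorem 7.4: over the basic cylindrical region `B = {r₁ ≤ r ≤ r₂, α ≤ θ ≤ β, z₁ ≤ z ≤ z₂}`,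
`∭_B f dV = ∫_{r₁}^{r₂} ∫_α^β ∫_{z₁}^{z₂} f(r cos θ, r sin θ, z) r dz dθ dr` ("`dV = r dr dθ dz`"), Example 7.5 the
solid cylinder.  Sect. 5.8 (spherical coordinates, Def. 8.1: `x = ρ sin φ cos θ`, `y = ρ sin φ sin θ`, `z = ρ cos φ`,
`ρ ≥ 0` the distance to the origin, `φ ∈ [0, π]` the colatitude measured from the positive `z`-axis, `θ` the polar
angle of `(x, y)`), Def. 8.4 the basic spherical region `{ρ₁ ≤ ρ ≤ ρ₂, φ₁ ≤ φ ≤ φ₂, α ≤ θ ≤ β}`, Theorem 8.5: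
`∭_B f dV = ∫_{ρ₁}^{ρ₂} ∫_{φ₁}^{φ₂} ∫_α^β f ρ² sin φ dθ dφ dρ` ("`dV = ρ² sin φ dρ dφ dθ`"), Example 8.6 the ball.
We prove both for Lebesgue integrals on `(ℝ × ℝ) × ℝ` (a point is `((x, y), z)`), from Mathlib's change of
variables `MeasureTheory.integral_target_eq_integral_abs_det_fderiv_smul` for an `OpenPartialHomeomorph`, applied
to charts assembled from Mathlib's planar `polarCoord`.

WHAT IS PROVED (`volume` on `(ℝ × ℝ) × ℝ`):

* THE CHARTS.  `cylindricalCoord = polarCoord.prod (refl ℝ)` (`((x, y), z) ↦ ((r, θ), z)`, target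
  `((0, ∞) × (-π, π)) × ℝ`, Jacobian `fderivCylindricalCoordSymm` with `det = r`); the coordinate cycle `coordCycle3`
  (`((a, b), c) ↦ ((c, a), b)`, `|det| = 1` because its cube is the identity); `sphericalCoord =
  (cylindricalCoord.transHomeomorph coordCycle3).trans cylindricalCoord` (`((x, y), z) ↦ ((r, θ), z) ↦ ((z, r), θ) ↦
  ((ρ, φ), θ)` with `(ρ, φ) = polarCoord (z, r)`), so that DEFINITIONALLY `sphericalCoord.symm ((ρ, φ), θ) =
  ((ρ sin φ cos θ, ρ sin φ sin θ), ρ cos φ)` (`sphericalCoord_symm_apply`, `rfl`), with `ρ = √(x² + y² + z²)`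
  (`sphericalCoord_apply_fst_fst`), `φ = arg (z + i √(x² + y²)) ∈ [0, π]`, `θ = arg (x + iy)`; `sphericalCoord_source`
  (all of space but the half-plane `y = 0, x ≤ 0`, `=ᵐ univ`), `sphericalCoord_target = ((0, ∞) × (0, π)) × (-π, π)`,
  the chain-rule Jacobian `fderivSphericalCoordSymm` with `|det| = ρ² |sin φ|` (`abs_det_fderivSphericalCoordSymm`);
  measurability of both charts.
* THE CHANGES OF VARIABLES, no hypothesis on `f` (`E`-valued):
  `integral_comp_cylindricalCoord_symm : ∫ q in cylindricalCoord.target, q.1.1 • f (cylindricalCoord.symm q) = ∫ p, f p`,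
  `integral_comp_sphericalCoord_symm : ∫ q in sphericalCoord.target, (q.1.1 ^ 2 * sin q.1.2) • f (sphericalCoord.symm q)
  = ∫ p, f p`; the integrability transfers `integrableOn_cylindricalCoord_target`, `integrableOn_sphericalCoord_target`.
* THE REGIONS.  `cylindricalBox r₁ r₂ α β z₁ z₂ = {p | cylindricalCoord p ∈ ([r₁, r₂] × [α, β]) × [z₁, z₂]}`,
  `cylindricalBox_eq_cylinder` (`[0, R] × [-π, π] × [z₁, z₂]` is the solid cylinder `{x² + y² ≤ R², z₁ ≤ z ≤ z₂}`);
  `sphericalBox ρ₁ ρ₂ φ₁ φ₂ α β = {p | sphericalCoord p ∈ ([ρ₁, ρ₂] × [φ₁, φ₂]) × [α, β]}`, `sphericalBox_eq_shell`,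
  `sphericalBox_eq_ball` (`[0, R] × [0, π] × [-π, π]` is `{x² + y² + z² ≤ R²}` — NOT `Metric.closedBall 0 R`, the norm
  of `(ℝ × ℝ) × ℝ` being the sup norm); measurability; `setIntegral_cylindricalBox_eq_setIntegral_box` and
  `setIntegral_sphericalBox_eq_setIntegral_box` (the set integral as an integral of the weighted integrand over the
  box cut by the target, NO hypothesis on `f`); `IntegrableOn.cylindricalIntegrand_of_cylindricalBox`,
  `IntegrableOn.sphericalIntegrand_of_sphericalBox`, `Continuous.integrableOn_{cylindrical,spherical}Integrand_box`.
* THEOREM 7.4: `setIntegral_cylindricalBox_eq_iterated` — for `0 ≤ r₁ ≤ r₂`, `-π ≤ α ≤ β ≤ π`, `z₁ ≤ z₂` and `f`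
  integrable on `B`, `∫ p in B, f p = ∫ r in r₁..r₂, ∫ θ in α..β, ∫ z in z₁..z₂, r * f ((r cos θ, r sin θ), z)`;
  `…_of_integrableOn_box` (weakest hypothesis), `…_of_continuous` (no side condition), the solid cylinder
  `setIntegral_solidCylinder_eq_iterated(_of_continuous)`.
* THEOREM 8.5: `setIntegral_sphericalBox_eq_iterated` — for `0 ≤ ρ₁ ≤ ρ₂`, `0 ≤ φ₁ ≤ φ₂ ≤ π`, `-π ≤ α ≤ β ≤ π` and
  `f` integrable on `B`, `∫ p in B, f p = ∫ ρ in ρ₁..ρ₂, ∫ φ in φ₁..φ₂, ∫ θ in α..β,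
  ρ ^ 2 * sin φ * f ((ρ sin φ cos θ, ρ sin φ sin θ), ρ cos φ)`; `…_of_integrableOn_box`, `…_of_continuous`, the ball
  `setIntegral_ball_eq_iterated(_of_continuous)` (Example 8.6 in general form) and the shell
  `setIntegral_shell_eq_iterated`.
* Glue: `setIntegral_prod_prod_eq_iterated` (Fubini on a triple box `(A × B) × C` for an integrable function).

WHY IT IS HERE.  The right-hand sides are integrals over a BOX with constant limits, the form the kernel-checked box
cubature certificates (`Literature/Analysis/ValidatedNumerics/GaussLegendreCertND`, `GaussLegendreCertIterated`,
`TaylorModelIntegralCert2D*`) consume, so integrals over balls, shells, cones cut by spheres, solid cylinders and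
their sectors become certifiable — regions the variable-limit route (`RegionBetweenIntegral3D.lean`) reaches only
through `√`-limits that violate its endpoint conditions.  In-tree neighbours: `PolarSectorIntegral.lean` (the plane);
`Literature/Analysis/Calculus/PlanarPolarIntegral.lean` (whole-plane iterated polar integral);
`Literature/Analysis/FluidPDE/PeriodicCylinderCoordinates.lean` (a cylindrical change of variables on `ℝ × (ℝ × ℝ)`,
`z` first, inside a heavy import closure — the pattern of the chain-rule Jacobian is the same); volume-only ball
computations elsewhere in Mathlib (`EuclideanSpace`).  New here: cylindrical AND spherical charts of `(ℝ × ℝ) × ℝ` as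
`OpenPartialHomeomorph`s with their Jacobians, the hypothesis-free changes of variables, and SET integrals over
bounded cylindrical / spherical boxes as INTERVAL integrals over a compact box.  HONEST FRAMING: textbook identities
formalised as glue for shared numerical engines serving client cells; rigour lives in the kernel-checked verifiers;
every published number belongs to a client cell's ledger, not to the engines group.  Deliberately NOT here: the
`π`-free half-angle forms of the full angular ranges (fold `θ` as in `PolarSectorIntegral.lean`; `φ ∈ [0, π]` needs
its own folding), regions between two spherical graphs `ρ = h(φ, θ)`, improper (unbounded) regions, general `ℝⁿ`.
Everything is proved; no named fact, no axiom, no `sorry`.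

References: [cite: Hurley1980, Sect. 5.7 Thm. 7.4]; [cite: Hurley1980, Sect. 5.8 Thm. 8.5];
[cite: DavisRabinowitz1984, Sect. 5.6.1 (5.6.1.1)].

AI-produced formalisation (H21 engines group, seat eng-quad-3 gen 66, 2026-08-24).
-/

noncomputable section

open _root_.MeasureTheory Set intervalIntegral Real
open scoped Interval

namespace Literature.MeasureTheory.Integral

/-! ### Cylindrical coordinates on `(ℝ × ℝ) × ℝ` -/

/-- Cylindrical coordinates `((x, y), z) ↦ ((r, θ), z)` on `(ℝ × ℝ) × ℝ`: Mathlib's `polarCoord` on the first factor,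
the identity on the second (`r = √(x² + y²)`, `θ = arg (x + iy) ∈ (-π, π]`). [cite: Hurley1980, Sect. 5.7 Def. 7.1] -/
def cylindricalCoord : OpenPartialHomeomorph ((ℝ × ℝ) × ℝ) ((ℝ × ℝ) × ℝ) :=
  polarCoord.prod (OpenPartialHomeomorph.refl ℝ)

/-- [cite: Hurley1980, Sect. 5.7 Def. 7.1] -/
@[simp] theorem cylindricalCoord_apply (p : (ℝ × ℝ) × ℝ) : cylindricalCoord p = (polarCoord p.1, p.2) := rfl

/-- `x = r cos θ`, `y = r sin θ`, `z = z`. [cite: Hurley1980, Sect. 5.7 Def. 7.1] -/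
@[simp] theorem cylindricalCoord_symm_apply (q : (ℝ × ℝ) × ℝ) :
    cylindricalCoord.symm q = ((q.1.1 * cos q.1.2, q.1.1 * sin q.1.2), q.2) := rfl

/-- [cite: Hurley1980, Sect. 5.7 Def. 7.1] -/
theorem cylindricalCoord_source : cylindricalCoord.source = polarCoord.source ×ˢ (univ : Set ℝ) := rfl

/-- The cylindrical chart's target is `((0, ∞) × (-π, π)) × ℝ`. [cite: Hurley1980, Sect. 5.7 Def. 7.1] -/
theorem cylindricalCoord_target : cylindricalCoord.target = (Ioi (0 : ℝ) ×ˢ Ioo (-π) π) ×ˢ (univ : Set ℝ) := rfl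

/-- The derivative of `cylindricalCoord.symm`: the polar Jacobian on the first factor, the identity on the second.
[cite: Hurley1980, Sect. 5.7 Thm. 7.4] -/
def fderivCylindricalCoordSymm (q : (ℝ × ℝ) × ℝ) : ((ℝ × ℝ) × ℝ) →L[ℝ] ((ℝ × ℝ) × ℝ) :=
  (fderivPolarCoordSymm q.1).prodMap (ContinuousLinearMap.id ℝ ℝ)

/-- [cite: Hurley1980, Sect. 5.7 Thm. 7.4] -/
theorem hasFDerivAt_cylindricalCoord_symm (q : (ℝ × ℝ) × ℝ) :
    HasFDerivAt cylindricalCoord.symm (fderivCylindricalCoordSymm q) q := by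
  have h := (hasFDerivAt_polarCoord_symm q.1).prodMap q (hasFDerivAt_id q.2)
  exact h

/-- The cylindrical Jacobian determinant is `r`. [cite: Hurley1980, Sect. 5.7 Thm. 7.4] -/
theorem det_fderivCylindricalCoordSymm (q : (ℝ × ℝ) × ℝ) : (fderivCylindricalCoordSymm q).det = q.1.1 := by
  rw [← det_fderivPolarCoordSymm q.1]
  simp only [fderivCylindricalCoordSymm, ContinuousLinearMap.det, ContinuousLinearMap.coe_prodMap,
    ContinuousLinearMap.coe_id, LinearMap.det_prodMap, LinearMap.det_id, mul_one]

/-- This instance is required to see through the defeq `volume = volume.prod volume` on `(ℝ × ℝ) × ℝ`.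
[cite: Hurley1980, Sect. 5.7 Thm. 7.4] -/
instance instIsAddHaarMeasureVolumeProdProdReal : (volume : Measure ((ℝ × ℝ) × ℝ)).IsAddHaarMeasure :=
  Measure.prod.instIsAddHaarMeasure _ _

/-- The cylindrical chart covers all of space but a null set (the half-plane `y = 0, x ≤ 0`).
[cite: Hurley1980, Sect. 5.7 Thm. 7.4] -/
theorem cylindricalCoord_source_ae_eq_univ : cylindricalCoord.source =ᵐ[volume] univ := by
  rw [ae_eq_univ, cylindricalCoord_source]
  have hc : (polarCoord.source ×ˢ (univ : Set ℝ))ᶜ = polarCoord.sourceᶜ ×ˢ (univ : Set ℝ) := by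
    ext p; simp only [mem_compl_iff, mem_prod, mem_univ, and_true]
  have h0 : volume (polarCoord.sourceᶜ) = 0 := ae_eq_univ.1 polarCoord_source_ae_eq_univ
  rw [hc, Measure.volume_eq_prod, Measure.prod_prod, h0, zero_mul]

/-- **Change of variables to cylindrical coordinates** (`dV = r dr dθ dz`), no hypothesis on `f`:
`∫ q in cylindricalCoord.target, q.1.1 • f (cylindricalCoord.symm q) = ∫ p, f p`.
[cite: Hurley1980, Sect. 5.7 Thm. 7.4] -/
theorem integral_comp_cylindricalCoord_symm {E : Type*} [NormedAddCommGroup E] [NormedSpace ℝ E]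
    (f : (ℝ × ℝ) × ℝ → E) :
    ∫ q in cylindricalCoord.target, q.1.1 • f (cylindricalCoord.symm q) = ∫ p, f p := by
  symm
  calc
    ∫ p, f p = ∫ p in cylindricalCoord.source, f p := by
      rw [← setIntegral_univ]
      apply setIntegral_congr_set
      exact cylindricalCoord_source_ae_eq_univ.symm
    _ = ∫ q in cylindricalCoord.target, |(fderivCylindricalCoordSymm q).det| • f (cylindricalCoord.symm q) := by
      rw [← OpenPartialHomeomorph.symm_target,
        integral_target_eq_integral_abs_det_fderiv_smul volume (fun q _ => hasFDerivAt_cylindricalCoord_symm q),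
        OpenPartialHomeomorph.symm_source]
    _ = ∫ q in cylindricalCoord.target, q.1.1 • f (cylindricalCoord.symm q) := by
      refine setIntegral_congr_fun cylindricalCoord.open_target.measurableSet fun q hq => ?_
      rw [det_fderivCylindricalCoordSymm, abs_of_pos hq.1.1]

/-! ### Spherical coordinates on `(ℝ × ℝ) × ℝ` -/

/-- The coordinate cycle `((a, b), c) ↦ ((c, a), b)` of `(ℝ × ℝ) × ℝ` (a linear isometry, `|det| = 1`). [folklore]
[cite: Hurley1980, Sect. 5.8 Def. 8.1] -/
def coordCycle3 : ((ℝ × ℝ) × ℝ) ≃L[ℝ] ((ℝ × ℝ) × ℝ) where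
  toFun p := ((p.2, p.1.1), p.1.2)
  invFun p := ((p.1.2, p.2), p.1.1)
  map_add' _ _ := rfl
  map_smul' _ _ := rfl
  left_inv _ := rfl
  right_inv _ := rfl
  continuous_toFun := by fun_prop
  continuous_invFun := by fun_prop

/-- [folklore] [cite: Hurley1980, Sect. 5.8 Def. 8.1] -/
@[simp] theorem coordCycle3_apply (p : (ℝ × ℝ) × ℝ) : coordCycle3 p = ((p.2, p.1.1), p.1.2) := rfl

/-- [folklore] [cite: Hurley1980, Sect. 5.8 Def. 8.1] -/
@[simp] theorem coordCycle3_symm_apply (p : (ℝ × ℝ) × ℝ) : coordCycle3.symm p = ((p.1.2, p.2), p.1.1) := rfl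

/-- Spherical coordinates `((x, y), z) ↦ ((ρ, φ), θ)` on `(ℝ × ℝ) × ℝ` (`ρ = √(x² + y² + z²)`, `φ ∈ [0, π]` the
colatitude measured from the positive `z`-axis, `θ ∈ (-π, π]` the polar angle of `(x, y)`), built from two copies of
the cylindrical chart: `((x, y), z) ↦ ((r, θ), z) ↦ ((z, r), θ) ↦ ((ρ, φ), θ)` with `(ρ, φ) = polarCoord (z, r)`.
[cite: Hurley1980, Sect. 5.8 Def. 8.1] -/
def sphericalCoord : OpenPartialHomeomorph ((ℝ × ℝ) × ℝ) ((ℝ × ℝ) × ℝ) :=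
  (cylindricalCoord.transHomeomorph coordCycle3.toHomeomorph).trans cylindricalCoord

/-- `x = ρ sin φ cos θ`, `y = ρ sin φ sin θ`, `z = ρ cos φ`. [cite: Hurley1980, Sect. 5.8 Def. 8.1] -/
@[simp] theorem sphericalCoord_symm_apply (q : (ℝ × ℝ) × ℝ) :
    sphericalCoord.symm q =
      ((q.1.1 * sin q.1.2 * cos q.2, q.1.1 * sin q.1.2 * sin q.2), q.1.1 * cos q.1.2) := rfl

/-- [cite: Hurley1980, Sect. 5.8 Def. 8.1] -/
theorem sphericalCoord_apply (p : (ℝ × ℝ) × ℝ) :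
    sphericalCoord p = (polarCoord (p.2, (polarCoord p.1).1), (polarCoord p.1).2) := rfl

/-- `ρ = √(x² + y² + z²)`. [cite: Hurley1980, Sect. 5.8 Def. 8.1] -/
theorem sphericalCoord_apply_fst_fst (p : (ℝ × ℝ) × ℝ) :
    (sphericalCoord p).1.1 = √(p.1.1 ^ 2 + p.1.2 ^ 2 + p.2 ^ 2) := by
  rw [sphericalCoord_apply, polarCoord_apply, polarCoord_apply]
  dsimp only
  rw [Real.sq_sqrt (by positivity)]
  ring_nf

/-- `φ = arg (z + i √(x² + y²))`. [cite: Hurley1980, Sect. 5.8 Def. 8.1] -/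
theorem sphericalCoord_apply_fst_snd (p : (ℝ × ℝ) × ℝ) :
    (sphericalCoord p).1.2 = Complex.arg (Complex.equivRealProd.symm (p.2, √(p.1.1 ^ 2 + p.1.2 ^ 2))) := rfl

/-- `θ = arg (x + iy)`. [cite: Hurley1980, Sect. 5.8 Def. 8.1] -/
theorem sphericalCoord_apply_snd (p : (ℝ × ℝ) × ℝ) :
    (sphericalCoord p).2 = Complex.arg (Complex.equivRealProd.symm p.1) := rfl

/-- The spherical chart has the same source as the cylindrical one (off the half-plane `y = 0, x ≤ 0`).
[cite: Hurley1980, Sect. 5.8 Def. 8.1] -/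
theorem sphericalCoord_source : sphericalCoord.source = polarCoord.source ×ˢ (univ : Set ℝ) := by
  ext p
  simp only [sphericalCoord, OpenPartialHomeomorph.trans_source, OpenPartialHomeomorph.transHomeomorph_source,
    cylindricalCoord_source, mem_inter_iff, mem_preimage, OpenPartialHomeomorph.transHomeomorph_apply,
    Function.comp_apply, cylindricalCoord_apply, ContinuousLinearEquiv.coe_toHomeomorph,
    coordCycle3_apply, mem_prod, mem_univ, and_true, and_iff_left_iff_imp]
  intro hp
  right
  show √(p.1.1 ^ 2 + p.1.2 ^ 2) ≠ 0
  have h : 0 < p.1.1 ^ 2 + p.1.2 ^ 2 := by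
    rcases hp with h | h
    · have h' : (0 : ℝ) < p.1.1 := h
      positivity
    · have h' : p.1.2 ≠ (0 : ℝ) := h
      positivity
  exact (Real.sqrt_pos.2 h).ne'

/-- The spherical chart's target is `((0, ∞) × (0, π)) × (-π, π)`. [cite: Hurley1980, Sect. 5.8 Def. 8.1] -/
theorem sphericalCoord_target : sphericalCoord.target = (Ioi (0 : ℝ) ×ˢ Ioo 0 π) ×ˢ Ioo (-π) π := by
  ext q
  simp only [sphericalCoord, OpenPartialHomeomorph.trans_target, OpenPartialHomeomorph.transHomeomorph_target,
    cylindricalCoord_target, mem_inter_iff, mem_preimage, cylindricalCoord_symm_apply, Homeomorph.symm,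
    mem_prod, mem_univ, and_true, mem_Ioi, mem_Ioo]
  constructor
  · rintro ⟨⟨hρ, hφ1, hφ2⟩, hs, hθ⟩
    have hs' : 0 < q.1.1 * sin q.1.2 := hs
    have hsin : 0 < sin q.1.2 := pos_of_mul_pos_right hs' hρ.le
    refine ⟨⟨hρ, ?_, hφ2⟩, hθ⟩
    by_contra hle
    exact absurd (sin_nonpos_of_nonpos_of_neg_pi_le (not_lt.1 hle) hφ1.le) (not_le.2 hsin)
  · rintro ⟨⟨hρ, hφ0, hφπ⟩, hθ⟩
    exact ⟨⟨hρ, by linarith, hφπ⟩, mul_pos hρ (sin_pos_of_pos_of_lt_pi hφ0 hφπ), hθ⟩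

/-- The derivative of `sphericalCoord.symm` (chain rule through the two cylindrical charts and the cycle).
[cite: Hurley1980, Sect. 5.8 Thm. 8.5] -/
def fderivSphericalCoordSymm (q : (ℝ × ℝ) × ℝ) : ((ℝ × ℝ) × ℝ) →L[ℝ] ((ℝ × ℝ) × ℝ) :=
  (fderivCylindricalCoordSymm (coordCycle3.symm (cylindricalCoord.symm q))).comp
    ((coordCycle3.symm : ((ℝ × ℝ) × ℝ) →L[ℝ] ((ℝ × ℝ) × ℝ)).comp (fderivCylindricalCoordSymm q))

/-- [cite: Hurley1980, Sect. 5.8 Thm. 8.5] -/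
theorem hasFDerivAt_sphericalCoord_symm (q : (ℝ × ℝ) × ℝ) :
    HasFDerivAt sphericalCoord.symm (fderivSphericalCoordSymm q) q := by
  have h1 := hasFDerivAt_cylindricalCoord_symm q
  have h2 : HasFDerivAt (coordCycle3.symm : ((ℝ × ℝ) × ℝ) → ((ℝ × ℝ) × ℝ))
      (coordCycle3.symm : ((ℝ × ℝ) × ℝ) →L[ℝ] ((ℝ × ℝ) × ℝ)) (cylindricalCoord.symm q) :=
    coordCycle3.symm.hasFDerivAt
  have h3 := hasFDerivAt_cylindricalCoord_symm (coordCycle3.symm (cylindricalCoord.symm q))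
  have h := h3.comp q (h2.comp q h1)
  have e : (sphericalCoord.symm : ((ℝ × ℝ) × ℝ) → ((ℝ × ℝ) × ℝ)) =
      (cylindricalCoord.symm : ((ℝ × ℝ) × ℝ) → ((ℝ × ℝ) × ℝ)) ∘
        ((coordCycle3.symm : ((ℝ × ℝ) × ℝ) → ((ℝ × ℝ) × ℝ)) ∘ (cylindricalCoord.symm : ((ℝ × ℝ) × ℝ) → ((ℝ × ℝ) × ℝ))) := by
    funext x; rfl
  rw [e]
  exact h

/-- `|det|` of the coordinate cycle is `1` (its cube is the identity). [folklore] [cite: Hurley1980, Sect. 5.8 Thm. 8.5] -/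
theorem abs_det_coordCycle3_symm :
    |LinearMap.det ((coordCycle3.symm : ((ℝ × ℝ) × ℝ) →L[ℝ] ((ℝ × ℝ) × ℝ)) : ((ℝ × ℝ) × ℝ) →ₗ[ℝ] ((ℝ × ℝ) × ℝ))| = 1 := by
  set C : ((ℝ × ℝ) × ℝ) →ₗ[ℝ] ((ℝ × ℝ) × ℝ) :=
    ((coordCycle3.symm : ((ℝ × ℝ) × ℝ) →L[ℝ] ((ℝ × ℝ) × ℝ)) : ((ℝ × ℝ) × ℝ) →ₗ[ℝ] ((ℝ × ℝ) × ℝ)) with hC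
  have hcube : C.comp (C.comp C) = LinearMap.id := LinearMap.ext fun p => rfl
  have h3 : (LinearMap.det C) ^ 3 = 1 := by
    have h := congrArg LinearMap.det hcube
    rw [LinearMap.det_comp, LinearMap.det_comp, LinearMap.det_id] at h
    rw [pow_three]; exact h
  have h' : |LinearMap.det C| ^ 3 = 1 := by rw [← abs_pow, h3, abs_one]
  exact (pow_eq_one_iff_of_nonneg (abs_nonneg _) (by norm_num)).1 h'

/-- The spherical Jacobian: `|det| = ρ² |sin φ|` (`= ρ² sin φ` on the target). [cite: Hurley1980, Sect. 5.8 Thm. 8.5] -/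
theorem abs_det_fderivSphericalCoordSymm (q : (ℝ × ℝ) × ℝ) :
    |(fderivSphericalCoordSymm q).det| = q.1.1 ^ 2 * |sin q.1.2| := by
  have e1 : LinearMap.det ((fderivCylindricalCoordSymm q : ((ℝ × ℝ) × ℝ) →L[ℝ] ((ℝ × ℝ) × ℝ)) :
      ((ℝ × ℝ) × ℝ) →ₗ[ℝ] ((ℝ × ℝ) × ℝ)) = q.1.1 := det_fderivCylindricalCoordSymm q
  have e3 : LinearMap.det ((fderivCylindricalCoordSymm (coordCycle3.symm (cylindricalCoord.symm q)) :
      ((ℝ × ℝ) × ℝ) →L[ℝ] ((ℝ × ℝ) × ℝ)) : ((ℝ × ℝ) × ℝ) →ₗ[ℝ] ((ℝ × ℝ) × ℝ)) = q.1.1 * sin q.1.2 :=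
    det_fderivCylindricalCoordSymm _
  simp only [fderivSphericalCoordSymm, ContinuousLinearMap.det, ContinuousLinearMap.toLinearMap_comp,
    LinearMap.det_comp, abs_mul, e1, e3, abs_det_coordCycle3_symm]
  rw [one_mul, ← sq_abs q.1.1]
  ring

/-- The spherical chart covers all of space but a null set. [cite: Hurley1980, Sect. 5.8 Thm. 8.5] -/
theorem sphericalCoord_source_ae_eq_univ : sphericalCoord.source =ᵐ[volume] univ := by
  rw [sphericalCoord_source, ← cylindricalCoord_source]; exact cylindricalCoord_source_ae_eq_univ

/-- **Change of variables to spherical coordinates** (`dV = ρ² sin φ dρ dφ dθ`), no hypothesis on `f`: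
`∫ q in sphericalCoord.target, (q.1.1 ^ 2 * sin q.1.2) • f (sphericalCoord.symm q) = ∫ p, f p`.
[cite: Hurley1980, Sect. 5.8 Thm. 8.5] -/
theorem integral_comp_sphericalCoord_symm {E : Type*} [NormedAddCommGroup E] [NormedSpace ℝ E]
    (f : (ℝ × ℝ) × ℝ → E) :
    ∫ q in sphericalCoord.target, (q.1.1 ^ 2 * sin q.1.2) • f (sphericalCoord.symm q) = ∫ p, f p := by
  symm
  calc
    ∫ p, f p = ∫ p in sphericalCoord.source, f p := by
      rw [← setIntegral_univ]
      apply setIntegral_congr_set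
      exact sphericalCoord_source_ae_eq_univ.symm
    _ = ∫ q in sphericalCoord.target, |(fderivSphericalCoordSymm q).det| • f (sphericalCoord.symm q) := by
      rw [← OpenPartialHomeomorph.symm_target,
        integral_target_eq_integral_abs_det_fderiv_smul volume (fun q _ => hasFDerivAt_sphericalCoord_symm q),
        OpenPartialHomeomorph.symm_source]
    _ = ∫ q in sphericalCoord.target, (q.1.1 ^ 2 * sin q.1.2) • f (sphericalCoord.symm q) := by
      refine setIntegral_congr_fun sphericalCoord.open_target.measurableSet fun q hq => ?_
      rw [sphericalCoord_target] at hq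
      rw [abs_det_fderivSphericalCoordSymm, abs_of_pos (sin_pos_of_pos_of_lt_pi hq.1.2.1 hq.1.2.2)]

/-! ### One-dimensional glue: a set squeezed between `Ioo a b` and `Icc a b` carries the interval integral -/

/-- If `Ioo a b ⊆ s ⊆ Icc a b` (`a ≤ b`) then `∫ x in s, g x = ∫ x in a..b, g x` (Lebesgue measure has no atoms); a
private copy of the lemma of `PolarSectorIntegral.lean`, not imported here. [folklore]
[cite: Hurley1980, Sect. 5.7 Thm. 7.4] -/
private theorem setIntegral_eq_intervalIntegral_of_between {a b : ℝ} (hab : a ≤ b) {s : Set ℝ}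
    (h₁ : Ioo a b ⊆ s) (h₂ : s ⊆ Icc a b) (g : ℝ → ℝ) : ∫ x in s, g x = ∫ x in a..b, g x := by
  rw [intervalIntegral.integral_of_le hab]
  refine setIntegral_congr_set (ae_eq_set.2 ⟨?_, ?_⟩)
  · refine measure_mono_null (fun x hx => ?_) (measure_singleton a)
    obtain ⟨hxs, hxn⟩ := hx
    have hx' := h₂ hxs
    by_contra hxa
    exact hxn ⟨lt_of_le_of_ne hx'.1 (fun h => hxa h.symm), hx'.2⟩
  · refine measure_mono_null (fun x hx => ?_) (measure_singleton b)
    obtain ⟨hxI, hxn⟩ := hx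
    by_contra hxb
    exact hxn (h₁ ⟨hxI.1, lt_of_le_of_ne hxI.2 hxb⟩)

/-- Fubini on a triple box `(A ×ˢ B) ×ˢ C ⊆ (ℝ × ℝ) × ℝ`: an integrable function integrates iteratedly.
[folklore] [cite: Hurley1980, Sect. 5.7 Thm. 7.4] -/
theorem setIntegral_prod_prod_eq_iterated {A B C : Set ℝ} {G : (ℝ × ℝ) × ℝ → ℝ} (hG : IntegrableOn G ((A ×ˢ B) ×ˢ C)) :
    ∫ q in (A ×ˢ B) ×ˢ C, G q = ∫ a in A, ∫ b in B, ∫ c in C, G ((a, b), c) := by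
  have hG2 : IntegrableOn (fun u : ℝ × ℝ => ∫ c in C, G (u, c)) (A ×ˢ B) := by
    have h := hG
    rw [IntegrableOn, Measure.volume_eq_prod, ← Measure.prod_restrict] at h
    exact h.integral_prod_left
  rw [Measure.volume_eq_prod, setIntegral_prod _ hG, Measure.volume_eq_prod, setIntegral_prod _ hG2]

/-! ### Measurability of the charts -/

/-- `polarCoord` is measurable (private copy of the lemma of `PolarSectorIntegral.lean`). [folklore]
[cite: Hurley1980, Sect. 5.7 Def. 7.1] -/
private theorem measurable_polarCoord' : Measurable (polarCoord : ℝ × ℝ → ℝ × ℝ) := by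
  have h : (polarCoord : ℝ × ℝ → ℝ × ℝ) =
      fun q => (√(q.1 ^ 2 + q.2 ^ 2), Complex.arg (Complex.equivRealProd.symm q)) := by
    funext q; rfl
  rw [h]
  refine Measurable.prodMk (by fun_prop) (Complex.measurable_arg.comp ?_)
  exact Complex.equivRealProdCLM.symm.continuous.measurable

/-- The cylindrical chart is measurable. [cite: Hurley1980, Sect. 5.7 Def. 7.1] -/
theorem measurable_cylindricalCoord : Measurable (cylindricalCoord : (ℝ × ℝ) × ℝ → (ℝ × ℝ) × ℝ) := by
  have h : (cylindricalCoord : (ℝ × ℝ) × ℝ → (ℝ × ℝ) × ℝ) = fun p => (polarCoord p.1, p.2) := by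
    funext p; rfl
  rw [h]
  exact (measurable_polarCoord'.comp measurable_fst).prodMk measurable_snd

/-- The spherical chart is measurable. [cite: Hurley1980, Sect. 5.8 Def. 8.1] -/
theorem measurable_sphericalCoord : Measurable (sphericalCoord : (ℝ × ℝ) × ℝ → (ℝ × ℝ) × ℝ) := by
  have h : (sphericalCoord : (ℝ × ℝ) × ℝ → (ℝ × ℝ) × ℝ) =
      (cylindricalCoord : (ℝ × ℝ) × ℝ → (ℝ × ℝ) × ℝ) ∘
        ((coordCycle3 : (ℝ × ℝ) × ℝ → (ℝ × ℝ) × ℝ) ∘ (cylindricalCoord : (ℝ × ℝ) × ℝ → (ℝ × ℝ) × ℝ)) := by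
    funext p; rfl
  rw [h]
  exact measurable_cylindricalCoord.comp (coordCycle3.continuous.measurable.comp measurable_cylindricalCoord)

/-! ### Cylindrical boxes and solid cylinders (Sect. 5.7) -/

/-- The cylindrical box `{r₁ ≤ r ≤ r₂, α ≤ θ ≤ β, z₁ ≤ z ≤ z₂}` as a subset of space, through `cylindricalCoord`.
[cite: Hurley1980, Sect. 5.7 Thm. 7.4] -/
def cylindricalBox (r₁ r₂ α β z₁ z₂ : ℝ) : Set ((ℝ × ℝ) × ℝ) :=
  {p : (ℝ × ℝ) × ℝ | cylindricalCoord p ∈ (Icc r₁ r₂ ×ˢ Icc α β) ×ˢ Icc z₁ z₂}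

/-- [cite: Hurley1980, Sect. 5.7 Thm. 7.4] -/
theorem measurableSet_cylindricalBox (r₁ r₂ α β z₁ z₂ : ℝ) : MeasurableSet (cylindricalBox r₁ r₂ α β z₁ z₂) :=
  measurable_cylindricalCoord ((measurableSet_Icc.prod measurableSet_Icc).prod measurableSet_Icc)

/-- On the target: `((r cos θ, r sin θ), z)` lies in the cylindrical box iff `((r, θ), z)` lies in the box.
[cite: Hurley1980, Sect. 5.7 Thm. 7.4] -/
theorem cylindricalCoord_symm_mem_cylindricalBox {r₁ r₂ α β z₁ z₂ : ℝ} {q : (ℝ × ℝ) × ℝ}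
    (hq : q ∈ cylindricalCoord.target) :
    cylindricalCoord.symm q ∈ cylindricalBox r₁ r₂ α β z₁ z₂ ↔ q ∈ (Icc r₁ r₂ ×ˢ Icc α β) ×ˢ Icc z₁ z₂ := by
  simp only [cylindricalBox, mem_setOf_eq, cylindricalCoord.right_inv hq]

/-- For `0 ≤ R` the full-angle cylindrical box `[0, R] × [-π, π] × [z₁, z₂]` is the solid cylinder
`{x² + y² ≤ R², z₁ ≤ z ≤ z₂}`. [cite: Hurley1980, Sect. 5.7 Ex. 7.5] -/
theorem cylindricalBox_eq_cylinder {R : ℝ} (hR : 0 ≤ R) (z₁ z₂ : ℝ) :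
    cylindricalBox 0 R (-π) π z₁ z₂ = {p : (ℝ × ℝ) × ℝ | p.1.1 ^ 2 + p.1.2 ^ 2 ≤ R ^ 2 ∧ p.2 ∈ Icc z₁ z₂} := by
  ext p
  simp only [cylindricalBox, mem_setOf_eq, mem_prod, mem_Icc, cylindricalCoord_apply, polarCoord_apply]
  constructor
  · rintro ⟨⟨⟨-, h⟩, -⟩, hz⟩
    refine ⟨?_, hz⟩
    calc p.1.1 ^ 2 + p.1.2 ^ 2 = (√(p.1.1 ^ 2 + p.1.2 ^ 2)) ^ 2 := (Real.sq_sqrt (by positivity)).symm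
      _ ≤ R ^ 2 := by gcongr
  · rintro ⟨h, hz⟩
    refine ⟨⟨⟨Real.sqrt_nonneg _, ?_⟩, (Complex.neg_pi_lt_arg _).le, Complex.arg_le_pi _⟩, hz⟩
    calc √(p.1.1 ^ 2 + p.1.2 ^ 2) ≤ √(R ^ 2) := Real.sqrt_le_sqrt h
      _ = R := Real.sqrt_sq hR

/-- **Cylindrical change of variables on a cylindrical box**, no hypothesis on `f`:
`∫ p in B, f p = ∫ q in ((Ioi 0 ∩ Icc r₁ r₂) ×ˢ (Ioo (-π) π ∩ Icc α β)) ×ˢ Icc z₁ z₂, q.1.1 * f ((q.1.1 cos q.1.2, q.1.1 sin q.1.2), q.2)`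
(both sides are `0` together when not integrable). [cite: Hurley1980, Sect. 5.7 Thm. 7.4] -/
theorem setIntegral_cylindricalBox_eq_setIntegral_box (r₁ r₂ α β z₁ z₂ : ℝ) (f : (ℝ × ℝ) × ℝ → ℝ) :
    ∫ p in cylindricalBox r₁ r₂ α β z₁ z₂, f p =
      ∫ q in ((Ioi (0 : ℝ) ∩ Icc r₁ r₂) ×ˢ (Ioo (-π) π ∩ Icc α β)) ×ˢ Icc z₁ z₂,
        q.1.1 * f ((q.1.1 * cos q.1.2, q.1.1 * sin q.1.2), q.2) := by
  set S := cylindricalBox r₁ r₂ α β z₁ z₂ with hSdef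
  have hS : MeasurableSet S := measurableSet_cylindricalBox r₁ r₂ α β z₁ z₂
  have hB : MeasurableSet ((Icc r₁ r₂ ×ˢ Icc α β) ×ˢ Icc z₁ z₂) :=
    (measurableSet_Icc.prod measurableSet_Icc).prod measurableSet_Icc
  have hT : MeasurableSet cylindricalCoord.target := cylindricalCoord.open_target.measurableSet
  rw [← MeasureTheory.integral_indicator hS, ← integral_comp_cylindricalCoord_symm (S.indicator f)]
  have h1 : ∫ q in cylindricalCoord.target, q.1.1 • S.indicator f (cylindricalCoord.symm q) =
      ∫ q in cylindricalCoord.target, ((Icc r₁ r₂ ×ˢ Icc α β) ×ˢ Icc z₁ z₂).indicator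
        (fun q : (ℝ × ℝ) × ℝ => q.1.1 * f ((q.1.1 * cos q.1.2, q.1.1 * sin q.1.2), q.2)) q := by
    refine setIntegral_congr_fun hT fun q hq => ?_
    by_cases hqB : q ∈ (Icc r₁ r₂ ×ˢ Icc α β) ×ˢ Icc z₁ z₂
    · rw [indicator_of_mem hqB, indicator_of_mem ((cylindricalCoord_symm_mem_cylindricalBox hq).2 hqB),
        smul_eq_mul, cylindricalCoord_symm_apply]
    · rw [indicator_of_notMem hqB,
        indicator_of_notMem (fun h => hqB ((cylindricalCoord_symm_mem_cylindricalBox hq).1 h)), smul_zero]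
  rw [h1, setIntegral_indicator hB, cylindricalCoord_target, Set.prod_inter_prod, Set.prod_inter_prod, univ_inter]

/-- Whole-space integrability transfer to cylindrical coordinates: `f` integrable ⇒ the cylindrical integrand
`q ↦ q.1.1 • f (cylindricalCoord.symm q)` is integrable on the target. [cite: Hurley1980, Sect. 5.7 Thm. 7.4] -/
theorem integrableOn_cylindricalCoord_target {E : Type*} [NormedAddCommGroup E] [NormedSpace ℝ E]
    {f : (ℝ × ℝ) × ℝ → E} (hf : Integrable f) :
    IntegrableOn (fun q : (ℝ × ℝ) × ℝ => q.1.1 • f (cylindricalCoord.symm q)) cylindricalCoord.target := by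
  have hT : MeasurableSet cylindricalCoord.target := cylindricalCoord.open_target.measurableSet
  have h1 : IntegrableOn f (cylindricalCoord.symm '' cylindricalCoord.target) := hf.integrableOn
  rw [integrableOn_image_iff_integrableOn_abs_det_fderiv_smul volume hT
    (fun q _ => (hasFDerivAt_cylindricalCoord_symm q).hasFDerivWithinAt) cylindricalCoord.symm.injOn] at h1
  refine h1.congr_fun (fun q hq => ?_) hT
  show |(fderivCylindricalCoordSymm q).det| • f (cylindricalCoord.symm q) = q.1.1 • f (cylindricalCoord.symm q)
  rw [det_fderivCylindricalCoordSymm, abs_of_pos hq.1.1]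

/-- If `f` is integrable on the cylindrical box then the cylindrical integrand is integrable on the corresponding
box (its part inside the target, which is all that matters). [cite: Hurley1980, Sect. 5.7 Thm. 7.4] -/
theorem _root_.MeasureTheory.IntegrableOn.cylindricalIntegrand_of_cylindricalBox {r₁ r₂ α β z₁ z₂ : ℝ}
    {f : (ℝ × ℝ) × ℝ → ℝ} (hf : IntegrableOn f (cylindricalBox r₁ r₂ α β z₁ z₂)) :
    IntegrableOn (fun q : (ℝ × ℝ) × ℝ => q.1.1 * f ((q.1.1 * cos q.1.2, q.1.1 * sin q.1.2), q.2))
      (((Ioi (0 : ℝ) ∩ Icc r₁ r₂) ×ˢ (Ioo (-π) π ∩ Icc α β)) ×ˢ Icc z₁ z₂) := by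
  set S := cylindricalBox r₁ r₂ α β z₁ z₂ with hSdef
  have hS : MeasurableSet S := measurableSet_cylindricalBox r₁ r₂ α β z₁ z₂
  have hB : MeasurableSet ((Icc r₁ r₂ ×ˢ Icc α β) ×ˢ Icc z₁ z₂) :=
    (measurableSet_Icc.prod measurableSet_Icc).prod measurableSet_Icc
  have hT : MeasurableSet cylindricalCoord.target := cylindricalCoord.open_target.measurableSet
  have h1 : IntegrableOn (fun q : (ℝ × ℝ) × ℝ => q.1.1 • S.indicator f (cylindricalCoord.symm q))
      cylindricalCoord.target :=
    integrableOn_cylindricalCoord_target ((integrable_indicator_iff hS).2 hf)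
  have h2 : IntegrableOn (fun q : (ℝ × ℝ) × ℝ => q.1.1 * f ((q.1.1 * cos q.1.2, q.1.1 * sin q.1.2), q.2))
      (cylindricalCoord.target ∩ (Icc r₁ r₂ ×ˢ Icc α β) ×ˢ Icc z₁ z₂) := by
    refine (h1.mono_set inter_subset_left).congr_fun (fun q hq => ?_) (hT.inter hB)
    show q.1.1 • S.indicator f (cylindricalCoord.symm q) = q.1.1 * f ((q.1.1 * cos q.1.2, q.1.1 * sin q.1.2), q.2)
    rw [indicator_of_mem ((cylindricalCoord_symm_mem_cylindricalBox hq.1).2 hq.2), smul_eq_mul,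
      cylindricalCoord_symm_apply]
  rwa [cylindricalCoord_target, Set.prod_inter_prod, Set.prod_inter_prod, univ_inter] at h2

/-- The cylindrical integrand of a continuous `f` is integrable on the (compact) box.
[cite: Hurley1980, Sect. 5.7 Thm. 7.4] -/
theorem _root_.Continuous.integrableOn_cylindricalIntegrand_box {f : (ℝ × ℝ) × ℝ → ℝ} (hf : Continuous f)
    (r₁ r₂ α β z₁ z₂ : ℝ) :
    IntegrableOn (fun q : (ℝ × ℝ) × ℝ => q.1.1 * f ((q.1.1 * cos q.1.2, q.1.1 * sin q.1.2), q.2))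
      ((Icc r₁ r₂ ×ˢ Icc α β) ×ˢ Icc z₁ z₂) := by
  have hc : Continuous fun q : (ℝ × ℝ) × ℝ => q.1.1 * f ((q.1.1 * cos q.1.2, q.1.1 * sin q.1.2), q.2) := by
    fun_prop
  exact hc.continuousOn.integrableOn_compact ((isCompact_Icc.prod isCompact_Icc).prod isCompact_Icc)

/-- **Theorem 5.7.4, weakest hypothesis**: for `0 ≤ r₁ ≤ r₂`, `-π ≤ α ≤ β ≤ π`, `z₁ ≤ z₂` and the cylindrical
integrand integrable on the box,
`∫ p in B, f p = ∫ r in r₁..r₂, ∫ θ in α..β, ∫ z in z₁..z₂, r * f ((r cos θ, r sin θ), z)`.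
[cite: Hurley1980, Sect. 5.7 Thm. 7.4] -/
theorem setIntegral_cylindricalBox_eq_iterated_of_integrableOn_box {r₁ r₂ α β z₁ z₂ : ℝ} (hr₁ : 0 ≤ r₁)
    (hr : r₁ ≤ r₂) (hα : -π ≤ α) (hαβ : α ≤ β) (hβ : β ≤ π) (hz : z₁ ≤ z₂) {f : (ℝ × ℝ) × ℝ → ℝ}
    (hint : IntegrableOn (fun q : (ℝ × ℝ) × ℝ => q.1.1 * f ((q.1.1 * cos q.1.2, q.1.1 * sin q.1.2), q.2))
      (((Ioi (0 : ℝ) ∩ Icc r₁ r₂) ×ˢ (Ioo (-π) π ∩ Icc α β)) ×ˢ Icc z₁ z₂)) :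
    ∫ p in cylindricalBox r₁ r₂ α β z₁ z₂, f p =
      ∫ r in r₁..r₂, ∫ θ in α..β, ∫ z in z₁..z₂, r * f ((r * cos θ, r * sin θ), z) := by
  rw [setIntegral_cylindricalBox_eq_setIntegral_box, setIntegral_prod_prod_eq_iterated hint]
  have innerz : ∀ r θ : ℝ, ∫ z in Icc z₁ z₂, r * f ((r * cos θ, r * sin θ), z) =
      ∫ z in z₁..z₂, r * f ((r * cos θ, r * sin θ), z) := fun r θ =>
    setIntegral_eq_intervalIntegral_of_between hz Ioo_subset_Icc_self subset_rfl _
  have innerθ : ∀ r : ℝ, ∫ θ in Ioo (-π) π ∩ Icc α β, ∫ z in z₁..z₂, r * f ((r * cos θ, r * sin θ), z) =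
      ∫ θ in α..β, ∫ z in z₁..z₂, r * f ((r * cos θ, r * sin θ), z) := fun r =>
    setIntegral_eq_intervalIntegral_of_between hαβ (s := Ioo (-π) π ∩ Icc α β)
      (fun θ hθ => ⟨⟨lt_of_le_of_lt hα hθ.1, lt_of_lt_of_le hθ.2 hβ⟩, Ioo_subset_Icc_self hθ⟩)
      inter_subset_right _
  simp only [innerz, innerθ]
  exact setIntegral_eq_intervalIntegral_of_between hr (s := Ioi 0 ∩ Icc r₁ r₂)
    (fun r hrI => ⟨lt_of_le_of_lt hr₁ hrI.1, Ioo_subset_Icc_self hrI⟩) inter_subset_right _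

/-- **Hurley's Theorem 5.7.4** (triple integral in cylindrical coordinates by iteration): for `0 ≤ r₁ ≤ r₂`,
`-π ≤ α ≤ β ≤ π`, `z₁ ≤ z₂` and `f` integrable on the cylindrical box `B`,
`∫ p in B, f p = ∫ r in r₁..r₂, ∫ θ in α..β, ∫ z in z₁..z₂, r * f ((r cos θ, r sin θ), z)` — `dV = r dr dθ dz`.
[cite: Hurley1980, Sect. 5.7 Thm. 7.4] -/
theorem setIntegral_cylindricalBox_eq_iterated {r₁ r₂ α β z₁ z₂ : ℝ} (hr₁ : 0 ≤ r₁) (hr : r₁ ≤ r₂) (hα : -π ≤ α)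
    (hαβ : α ≤ β) (hβ : β ≤ π) (hz : z₁ ≤ z₂) {f : (ℝ × ℝ) × ℝ → ℝ}
    (hf : IntegrableOn f (cylindricalBox r₁ r₂ α β z₁ z₂)) :
    ∫ p in cylindricalBox r₁ r₂ α β z₁ z₂, f p =
      ∫ r in r₁..r₂, ∫ θ in α..β, ∫ z in z₁..z₂, r * f ((r * cos θ, r * sin θ), z) :=
  setIntegral_cylindricalBox_eq_iterated_of_integrableOn_box hr₁ hr hα hαβ hβ hz
    hf.cylindricalIntegrand_of_cylindricalBox

/-- **Theorem 5.7.4, continuous case**: no side condition. [cite: Hurley1980, Sect. 5.7 Thm. 7.4] -/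
theorem setIntegral_cylindricalBox_eq_iterated_of_continuous {r₁ r₂ α β z₁ z₂ : ℝ} (hr₁ : 0 ≤ r₁) (hr : r₁ ≤ r₂)
    (hα : -π ≤ α) (hαβ : α ≤ β) (hβ : β ≤ π) (hz : z₁ ≤ z₂) {f : (ℝ × ℝ) × ℝ → ℝ} (hf : Continuous f) :
    ∫ p in cylindricalBox r₁ r₂ α β z₁ z₂, f p =
      ∫ r in r₁..r₂, ∫ θ in α..β, ∫ z in z₁..z₂, r * f ((r * cos θ, r * sin θ), z) :=
  setIntegral_cylindricalBox_eq_iterated_of_integrableOn_box hr₁ hr hα hαβ hβ hz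
    ((hf.integrableOn_cylindricalIntegrand_box r₁ r₂ α β z₁ z₂).mono_set
      (prod_mono (prod_mono inter_subset_right inter_subset_right) subset_rfl))

/-- **The solid cylinder**: `∫ p in {x² + y² ≤ R², z₁ ≤ z ≤ z₂}, f p = ∫ r in 0..R, ∫ θ in -π..π, ∫ z in z₁..z₂,
r * f ((r cos θ, r sin θ), z)` for `0 ≤ R`, `z₁ ≤ z₂` and `f` integrable there. [cite: Hurley1980, Sect. 5.7 Ex. 7.5] -/
theorem setIntegral_solidCylinder_eq_iterated {R z₁ z₂ : ℝ} (hR : 0 ≤ R) (hz : z₁ ≤ z₂) {f : (ℝ × ℝ) × ℝ → ℝ}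
    (hf : IntegrableOn f {p : (ℝ × ℝ) × ℝ | p.1.1 ^ 2 + p.1.2 ^ 2 ≤ R ^ 2 ∧ p.2 ∈ Icc z₁ z₂}) :
    ∫ p in {p : (ℝ × ℝ) × ℝ | p.1.1 ^ 2 + p.1.2 ^ 2 ≤ R ^ 2 ∧ p.2 ∈ Icc z₁ z₂}, f p =
      ∫ r in (0 : ℝ)..R, ∫ θ in (-π)..π, ∫ z in z₁..z₂, r * f ((r * cos θ, r * sin θ), z) := by
  rw [← cylindricalBox_eq_cylinder hR] at hf ⊢
  exact setIntegral_cylindricalBox_eq_iterated le_rfl hR le_rfl (by linarith [pi_pos]) le_rfl hz hf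

/-- **The solid cylinder, continuous case**: no side condition. [cite: Hurley1980, Sect. 5.7 Ex. 7.5] -/
theorem setIntegral_solidCylinder_eq_iterated_of_continuous {R z₁ z₂ : ℝ} (hR : 0 ≤ R) (hz : z₁ ≤ z₂)
    {f : (ℝ × ℝ) × ℝ → ℝ} (hf : Continuous f) :
    ∫ p in {p : (ℝ × ℝ) × ℝ | p.1.1 ^ 2 + p.1.2 ^ 2 ≤ R ^ 2 ∧ p.2 ∈ Icc z₁ z₂}, f p =
      ∫ r in (0 : ℝ)..R, ∫ θ in (-π)..π, ∫ z in z₁..z₂, r * f ((r * cos θ, r * sin θ), z) := by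
  rw [← cylindricalBox_eq_cylinder hR]
  exact setIntegral_cylindricalBox_eq_iterated_of_continuous le_rfl hR le_rfl (by linarith [pi_pos]) le_rfl hz hf

/-! ### Spherical boxes, balls and shells (Sect. 5.8) -/

/-- The spherical box `{ρ₁ ≤ ρ ≤ ρ₂, φ₁ ≤ φ ≤ φ₂, α ≤ θ ≤ β}` as a subset of space, through `sphericalCoord`.
[cite: Hurley1980, Sect. 5.8 Def. 8.4] -/
def sphericalBox (ρ₁ ρ₂ φ₁ φ₂ α β : ℝ) : Set ((ℝ × ℝ) × ℝ) :=
  {p : (ℝ × ℝ) × ℝ | sphericalCoord p ∈ (Icc ρ₁ ρ₂ ×ˢ Icc φ₁ φ₂) ×ˢ Icc α β}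

/-- [cite: Hurley1980, Sect. 5.8 Def. 8.4] -/
theorem measurableSet_sphericalBox (ρ₁ ρ₂ φ₁ φ₂ α β : ℝ) : MeasurableSet (sphericalBox ρ₁ ρ₂ φ₁ φ₂ α β) :=
  measurable_sphericalCoord ((measurableSet_Icc.prod measurableSet_Icc).prod measurableSet_Icc)

/-- On the target: `sphericalCoord.symm q` lies in the spherical box iff `q = ((ρ, φ), θ)` lies in the box.
[cite: Hurley1980, Sect. 5.8 Def. 8.4] -/
theorem sphericalCoord_symm_mem_sphericalBox {ρ₁ ρ₂ φ₁ φ₂ α β : ℝ} {q : (ℝ × ℝ) × ℝ}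
    (hq : q ∈ sphericalCoord.target) :
    sphericalCoord.symm q ∈ sphericalBox ρ₁ ρ₂ φ₁ φ₂ α β ↔ q ∈ (Icc ρ₁ ρ₂ ×ˢ Icc φ₁ φ₂) ×ˢ Icc α β := by
  simp only [sphericalBox, mem_setOf_eq, sphericalCoord.right_inv hq]

/-- For `0 ≤ ρ₁, ρ₂` the full-angle spherical box `[ρ₁, ρ₂] × [0, π] × [-π, π]` is the spherical shell
`{ρ₁² ≤ x² + y² + z² ≤ ρ₂²}` (every colatitude `φ ∈ [0, π]` and every angle `θ ∈ (-π, π]` qualifies).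
[cite: Hurley1980, Sect. 5.8 Def. 8.4] -/
theorem sphericalBox_eq_shell {ρ₁ ρ₂ : ℝ} (hρ₁ : 0 ≤ ρ₁) (hρ₂ : 0 ≤ ρ₂) :
    sphericalBox ρ₁ ρ₂ 0 π (-π) π =
      {p : (ℝ × ℝ) × ℝ | ρ₁ ^ 2 ≤ p.1.1 ^ 2 + p.1.2 ^ 2 + p.2 ^ 2 ∧ p.1.1 ^ 2 + p.1.2 ^ 2 + p.2 ^ 2 ≤ ρ₂ ^ 2} := by
  ext p
  have eρ := sphericalCoord_apply_fst_fst p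
  have eφ := sphericalCoord_apply_fst_snd p
  have eθ := sphericalCoord_apply_snd p
  simp only [sphericalBox, mem_setOf_eq, mem_prod, mem_Icc]
  rw [eρ, eφ, eθ]
  have hs : 0 ≤ p.1.1 ^ 2 + p.1.2 ^ 2 + p.2 ^ 2 := by positivity
  constructor
  · rintro ⟨⟨⟨h₁, h₂⟩, -⟩, -⟩
    have e : p.1.1 ^ 2 + p.1.2 ^ 2 + p.2 ^ 2 = (√(p.1.1 ^ 2 + p.1.2 ^ 2 + p.2 ^ 2)) ^ 2 := (Real.sq_sqrt hs).symm
    refine ⟨?_, ?_⟩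
    · rw [e]; gcongr
    · rw [e]; gcongr
  · rintro ⟨h₁, h₂⟩
    refine ⟨⟨⟨?_, ?_⟩, ?_, Complex.arg_le_pi _⟩, (Complex.neg_pi_lt_arg _).le, Complex.arg_le_pi _⟩
    · calc ρ₁ = √(ρ₁ ^ 2) := (Real.sqrt_sq hρ₁).symm
        _ ≤ √(p.1.1 ^ 2 + p.1.2 ^ 2 + p.2 ^ 2) := Real.sqrt_le_sqrt h₁
    · calc √(p.1.1 ^ 2 + p.1.2 ^ 2 + p.2 ^ 2) ≤ √(ρ₂ ^ 2) := Real.sqrt_le_sqrt h₂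
        _ = ρ₂ := Real.sqrt_sq hρ₂
    · rw [Complex.arg_nonneg_iff]
      simp only [Complex.equivRealProd_symm_apply, Complex.add_im, Complex.ofReal_im, Complex.mul_im,
        Complex.ofReal_re, Complex.I_im, Complex.I_re, mul_one, mul_zero, add_zero, zero_add]
      exact Real.sqrt_nonneg _

/-- For `0 ≤ R` the spherical box `[0, R] × [0, π] × [-π, π]` is the closed ball `{x² + y² + z² ≤ R²}` (NOT
`Metric.closedBall 0 R`: the norm of `(ℝ × ℝ) × ℝ` is the sup norm). [cite: Hurley1980, Sect. 5.8 Ex. 8.6] -/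
theorem sphericalBox_eq_ball {R : ℝ} (hR : 0 ≤ R) :
    sphericalBox 0 R 0 π (-π) π = {p : (ℝ × ℝ) × ℝ | p.1.1 ^ 2 + p.1.2 ^ 2 + p.2 ^ 2 ≤ R ^ 2} := by
  rw [sphericalBox_eq_shell le_rfl hR]
  ext p
  simp only [mem_setOf_eq, and_iff_right_iff_imp]
  intro _
  rw [zero_pow two_ne_zero]
  positivity

/-- **Spherical change of variables on a spherical box**, no hypothesis on `f`:
`∫ p in B, f p = ∫ q in ((Ioi 0 ∩ Icc ρ₁ ρ₂) ×ˢ (Ioo 0 π ∩ Icc φ₁ φ₂)) ×ˢ (Ioo (-π) π ∩ Icc α β),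
ρ² sin φ · f ((ρ sin φ cos θ, ρ sin φ sin θ), ρ cos φ)` (`q = ((ρ, φ), θ)`; both sides `0` together when not
integrable). [cite: Hurley1980, Sect. 5.8 Thm. 8.5] -/
theorem setIntegral_sphericalBox_eq_setIntegral_box (ρ₁ ρ₂ φ₁ φ₂ α β : ℝ) (f : (ℝ × ℝ) × ℝ → ℝ) :
    ∫ p in sphericalBox ρ₁ ρ₂ φ₁ φ₂ α β, f p =
      ∫ q in ((Ioi (0 : ℝ) ∩ Icc ρ₁ ρ₂) ×ˢ (Ioo 0 π ∩ Icc φ₁ φ₂)) ×ˢ (Ioo (-π) π ∩ Icc α β),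
        q.1.1 ^ 2 * sin q.1.2 *
          f ((q.1.1 * sin q.1.2 * cos q.2, q.1.1 * sin q.1.2 * sin q.2), q.1.1 * cos q.1.2) := by
  set S := sphericalBox ρ₁ ρ₂ φ₁ φ₂ α β with hSdef
  have hS : MeasurableSet S := measurableSet_sphericalBox ρ₁ ρ₂ φ₁ φ₂ α β
  have hB : MeasurableSet ((Icc ρ₁ ρ₂ ×ˢ Icc φ₁ φ₂) ×ˢ Icc α β) :=
    (measurableSet_Icc.prod measurableSet_Icc).prod measurableSet_Icc
  have hT : MeasurableSet sphericalCoord.target := sphericalCoord.open_target.measurableSet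
  rw [← MeasureTheory.integral_indicator hS, ← integral_comp_sphericalCoord_symm (S.indicator f)]
  have h1 : ∫ q in sphericalCoord.target, (q.1.1 ^ 2 * sin q.1.2) • S.indicator f (sphericalCoord.symm q) =
      ∫ q in sphericalCoord.target, ((Icc ρ₁ ρ₂ ×ˢ Icc φ₁ φ₂) ×ˢ Icc α β).indicator
        (fun q : (ℝ × ℝ) × ℝ => q.1.1 ^ 2 * sin q.1.2 *
          f ((q.1.1 * sin q.1.2 * cos q.2, q.1.1 * sin q.1.2 * sin q.2), q.1.1 * cos q.1.2)) q := by
    refine setIntegral_congr_fun hT fun q hq => ?_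
    by_cases hqB : q ∈ (Icc ρ₁ ρ₂ ×ˢ Icc φ₁ φ₂) ×ˢ Icc α β
    · rw [indicator_of_mem hqB, indicator_of_mem ((sphericalCoord_symm_mem_sphericalBox hq).2 hqB),
        smul_eq_mul, sphericalCoord_symm_apply]
    · rw [indicator_of_notMem hqB,
        indicator_of_notMem (fun h => hqB ((sphericalCoord_symm_mem_sphericalBox hq).1 h)), smul_zero]
  rw [h1, setIntegral_indicator hB, sphericalCoord_target, Set.prod_inter_prod, Set.prod_inter_prod]

/-- Whole-space integrability transfer to spherical coordinates: `f` integrable ⇒ the spherical integrand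
`q ↦ (ρ² sin φ) • f (sphericalCoord.symm q)` is integrable on the target. [cite: Hurley1980, Sect. 5.8 Thm. 8.5] -/
theorem integrableOn_sphericalCoord_target {E : Type*} [NormedAddCommGroup E] [NormedSpace ℝ E]
    {f : (ℝ × ℝ) × ℝ → E} (hf : Integrable f) :
    IntegrableOn (fun q : (ℝ × ℝ) × ℝ => (q.1.1 ^ 2 * sin q.1.2) • f (sphericalCoord.symm q))
      sphericalCoord.target := by
  have hT : MeasurableSet sphericalCoord.target := sphericalCoord.open_target.measurableSet
  have h1 : IntegrableOn f (sphericalCoord.symm '' sphericalCoord.target) := hf.integrableOn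
  rw [integrableOn_image_iff_integrableOn_abs_det_fderiv_smul volume hT
    (fun q _ => (hasFDerivAt_sphericalCoord_symm q).hasFDerivWithinAt) sphericalCoord.symm.injOn] at h1
  refine h1.congr_fun (fun q hq => ?_) hT
  show |(fderivSphericalCoordSymm q).det| • f (sphericalCoord.symm q) =
    (q.1.1 ^ 2 * sin q.1.2) • f (sphericalCoord.symm q)
  rw [sphericalCoord_target] at hq
  rw [abs_det_fderivSphericalCoordSymm, abs_of_pos (sin_pos_of_pos_of_lt_pi hq.1.2.1 hq.1.2.2)]

/-- If `f` is integrable on the spherical box then the spherical integrand is integrable on the corresponding box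
(its part inside the target). [cite: Hurley1980, Sect. 5.8 Thm. 8.5] -/
theorem _root_.MeasureTheory.IntegrableOn.sphericalIntegrand_of_sphericalBox {ρ₁ ρ₂ φ₁ φ₂ α β : ℝ}
    {f : (ℝ × ℝ) × ℝ → ℝ} (hf : IntegrableOn f (sphericalBox ρ₁ ρ₂ φ₁ φ₂ α β)) :
    IntegrableOn (fun q : (ℝ × ℝ) × ℝ => q.1.1 ^ 2 * sin q.1.2 *
        f ((q.1.1 * sin q.1.2 * cos q.2, q.1.1 * sin q.1.2 * sin q.2), q.1.1 * cos q.1.2))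
      (((Ioi (0 : ℝ) ∩ Icc ρ₁ ρ₂) ×ˢ (Ioo 0 π ∩ Icc φ₁ φ₂)) ×ˢ (Ioo (-π) π ∩ Icc α β)) := by
  set S := sphericalBox ρ₁ ρ₂ φ₁ φ₂ α β with hSdef
  have hS : MeasurableSet S := measurableSet_sphericalBox ρ₁ ρ₂ φ₁ φ₂ α β
  have hB : MeasurableSet ((Icc ρ₁ ρ₂ ×ˢ Icc φ₁ φ₂) ×ˢ Icc α β) :=
    (measurableSet_Icc.prod measurableSet_Icc).prod measurableSet_Icc
  have hT : MeasurableSet sphericalCoord.target := sphericalCoord.open_target.measurableSet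
  have h1 : IntegrableOn (fun q : (ℝ × ℝ) × ℝ => (q.1.1 ^ 2 * sin q.1.2) • S.indicator f (sphericalCoord.symm q))
      sphericalCoord.target :=
    integrableOn_sphericalCoord_target ((integrable_indicator_iff hS).2 hf)
  have h2 : IntegrableOn (fun q : (ℝ × ℝ) × ℝ => q.1.1 ^ 2 * sin q.1.2 *
        f ((q.1.1 * sin q.1.2 * cos q.2, q.1.1 * sin q.1.2 * sin q.2), q.1.1 * cos q.1.2))
      (sphericalCoord.target ∩ (Icc ρ₁ ρ₂ ×ˢ Icc φ₁ φ₂) ×ˢ Icc α β) := by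
    refine (h1.mono_set inter_subset_left).congr_fun (fun q hq => ?_) (hT.inter hB)
    show (q.1.1 ^ 2 * sin q.1.2) • S.indicator f (sphericalCoord.symm q) = q.1.1 ^ 2 * sin q.1.2 *
      f ((q.1.1 * sin q.1.2 * cos q.2, q.1.1 * sin q.1.2 * sin q.2), q.1.1 * cos q.1.2)
    rw [indicator_of_mem ((sphericalCoord_symm_mem_sphericalBox hq.1).2 hq.2), smul_eq_mul,
      sphericalCoord_symm_apply]
  rwa [sphericalCoord_target, Set.prod_inter_prod, Set.prod_inter_prod] at h2

/-- The spherical integrand of a continuous `f` is integrable on the (compact) box.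
[cite: Hurley1980, Sect. 5.8 Thm. 8.5] -/
theorem _root_.Continuous.integrableOn_sphericalIntegrand_box {f : (ℝ × ℝ) × ℝ → ℝ} (hf : Continuous f)
    (ρ₁ ρ₂ φ₁ φ₂ α β : ℝ) :
    IntegrableOn (fun q : (ℝ × ℝ) × ℝ => q.1.1 ^ 2 * sin q.1.2 *
        f ((q.1.1 * sin q.1.2 * cos q.2, q.1.1 * sin q.1.2 * sin q.2), q.1.1 * cos q.1.2))
      ((Icc ρ₁ ρ₂ ×ˢ Icc φ₁ φ₂) ×ˢ Icc α β) := by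
  have hc : Continuous fun q : (ℝ × ℝ) × ℝ => q.1.1 ^ 2 * sin q.1.2 *
      f ((q.1.1 * sin q.1.2 * cos q.2, q.1.1 * sin q.1.2 * sin q.2), q.1.1 * cos q.1.2) := by
    fun_prop
  exact hc.continuousOn.integrableOn_compact ((isCompact_Icc.prod isCompact_Icc).prod isCompact_Icc)

/-- **Theorem 5.8.5, weakest hypothesis**: for `0 ≤ ρ₁ ≤ ρ₂`, `0 ≤ φ₁ ≤ φ₂ ≤ π`, `-π ≤ α ≤ β ≤ π` and the
spherical integrand integrable on the box,
`∫ p in B, f p = ∫ ρ in ρ₁..ρ₂, ∫ φ in φ₁..φ₂, ∫ θ in α..β, ρ² sin φ · f ((ρ sin φ cos θ, ρ sin φ sin θ), ρ cos φ)`.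
[cite: Hurley1980, Sect. 5.8 Thm. 8.5] -/
theorem setIntegral_sphericalBox_eq_iterated_of_integrableOn_box {ρ₁ ρ₂ φ₁ φ₂ α β : ℝ} (hρ₁ : 0 ≤ ρ₁)
    (hρ : ρ₁ ≤ ρ₂) (hφ₁ : 0 ≤ φ₁) (hφ : φ₁ ≤ φ₂) (hφ₂ : φ₂ ≤ π) (hα : -π ≤ α) (hαβ : α ≤ β) (hβ : β ≤ π)
    {f : (ℝ × ℝ) × ℝ → ℝ}
    (hint : IntegrableOn (fun q : (ℝ × ℝ) × ℝ => q.1.1 ^ 2 * sin q.1.2 *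
        f ((q.1.1 * sin q.1.2 * cos q.2, q.1.1 * sin q.1.2 * sin q.2), q.1.1 * cos q.1.2))
      (((Ioi (0 : ℝ) ∩ Icc ρ₁ ρ₂) ×ˢ (Ioo 0 π ∩ Icc φ₁ φ₂)) ×ˢ (Ioo (-π) π ∩ Icc α β))) :
    ∫ p in sphericalBox ρ₁ ρ₂ φ₁ φ₂ α β, f p =
      ∫ ρ in ρ₁..ρ₂, ∫ φ in φ₁..φ₂, ∫ θ in α..β,
        ρ ^ 2 * sin φ * f ((ρ * sin φ * cos θ, ρ * sin φ * sin θ), ρ * cos φ) := by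
  rw [setIntegral_sphericalBox_eq_setIntegral_box, setIntegral_prod_prod_eq_iterated hint]
  have innerθ : ∀ ρ φ : ℝ, ∫ θ in Ioo (-π) π ∩ Icc α β,
      ρ ^ 2 * sin φ * f ((ρ * sin φ * cos θ, ρ * sin φ * sin θ), ρ * cos φ) =
      ∫ θ in α..β, ρ ^ 2 * sin φ * f ((ρ * sin φ * cos θ, ρ * sin φ * sin θ), ρ * cos φ) := fun ρ φ =>
    setIntegral_eq_intervalIntegral_of_between hαβ (s := Ioo (-π) π ∩ Icc α β)
      (fun θ hθ => ⟨⟨lt_of_le_of_lt hα hθ.1, lt_of_lt_of_le hθ.2 hβ⟩, Ioo_subset_Icc_self hθ⟩)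
      inter_subset_right _
  have innerφ : ∀ ρ : ℝ, ∫ φ in Ioo 0 π ∩ Icc φ₁ φ₂, ∫ θ in α..β,
      ρ ^ 2 * sin φ * f ((ρ * sin φ * cos θ, ρ * sin φ * sin θ), ρ * cos φ) =
      ∫ φ in φ₁..φ₂, ∫ θ in α..β, ρ ^ 2 * sin φ * f ((ρ * sin φ * cos θ, ρ * sin φ * sin θ), ρ * cos φ) :=
    fun ρ => setIntegral_eq_intervalIntegral_of_between hφ (s := Ioo 0 π ∩ Icc φ₁ φ₂)
      (fun φ hφI => ⟨⟨lt_of_le_of_lt hφ₁ hφI.1, lt_of_lt_of_le hφI.2 hφ₂⟩, Ioo_subset_Icc_self hφI⟩)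
      inter_subset_right _
  simp only [innerθ, innerφ]
  exact setIntegral_eq_intervalIntegral_of_between hρ (s := Ioi 0 ∩ Icc ρ₁ ρ₂)
    (fun ρ hρI => ⟨lt_of_le_of_lt hρ₁ hρI.1, Ioo_subset_Icc_self hρI⟩) inter_subset_right _

/-- **Hurley's Theorem 5.8.5** (triple integral in spherical coordinates by iteration): for `0 ≤ ρ₁ ≤ ρ₂`,
`0 ≤ φ₁ ≤ φ₂ ≤ π`, `-π ≤ α ≤ β ≤ π` and `f` integrable on the spherical box `B`,
`∫ p in B, f p = ∫ ρ in ρ₁..ρ₂, ∫ φ in φ₁..φ₂, ∫ θ in α..β, ρ² sin φ · f ((ρ sin φ cos θ, ρ sin φ sin θ), ρ cos φ)` —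
`dV = ρ² sin φ dρ dφ dθ`. [cite: Hurley1980, Sect. 5.8 Thm. 8.5] -/
theorem setIntegral_sphericalBox_eq_iterated {ρ₁ ρ₂ φ₁ φ₂ α β : ℝ} (hρ₁ : 0 ≤ ρ₁) (hρ : ρ₁ ≤ ρ₂) (hφ₁ : 0 ≤ φ₁)
    (hφ : φ₁ ≤ φ₂) (hφ₂ : φ₂ ≤ π) (hα : -π ≤ α) (hαβ : α ≤ β) (hβ : β ≤ π) {f : (ℝ × ℝ) × ℝ → ℝ}
    (hf : IntegrableOn f (sphericalBox ρ₁ ρ₂ φ₁ φ₂ α β)) :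
    ∫ p in sphericalBox ρ₁ ρ₂ φ₁ φ₂ α β, f p =
      ∫ ρ in ρ₁..ρ₂, ∫ φ in φ₁..φ₂, ∫ θ in α..β,
        ρ ^ 2 * sin φ * f ((ρ * sin φ * cos θ, ρ * sin φ * sin θ), ρ * cos φ) :=
  setIntegral_sphericalBox_eq_iterated_of_integrableOn_box hρ₁ hρ hφ₁ hφ hφ₂ hα hαβ hβ
    hf.sphericalIntegrand_of_sphericalBox

/-- **Theorem 5.8.5, continuous case**: no side condition. [cite: Hurley1980, Sect. 5.8 Thm. 8.5] -/
theorem setIntegral_sphericalBox_eq_iterated_of_continuous {ρ₁ ρ₂ φ₁ φ₂ α β : ℝ} (hρ₁ : 0 ≤ ρ₁) (hρ : ρ₁ ≤ ρ₂)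
    (hφ₁ : 0 ≤ φ₁) (hφ : φ₁ ≤ φ₂) (hφ₂ : φ₂ ≤ π) (hα : -π ≤ α) (hαβ : α ≤ β) (hβ : β ≤ π)
    {f : (ℝ × ℝ) × ℝ → ℝ} (hf : Continuous f) :
    ∫ p in sphericalBox ρ₁ ρ₂ φ₁ φ₂ α β, f p =
      ∫ ρ in ρ₁..ρ₂, ∫ φ in φ₁..φ₂, ∫ θ in α..β,
        ρ ^ 2 * sin φ * f ((ρ * sin φ * cos θ, ρ * sin φ * sin θ), ρ * cos φ) :=
  setIntegral_sphericalBox_eq_iterated_of_integrableOn_box hρ₁ hρ hφ₁ hφ hφ₂ hα hαβ hβ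
    ((hf.integrableOn_sphericalIntegrand_box ρ₁ ρ₂ φ₁ φ₂ α β).mono_set
      (prod_mono (prod_mono inter_subset_right inter_subset_right) inter_subset_right))

/-- **The ball** (Example 5.8.6 in general form): for `0 ≤ R` and `f` integrable on `{x² + y² + z² ≤ R²}`,
`∫ p in {x² + y² + z² ≤ R²}, f p = ∫ ρ in 0..R, ∫ φ in 0..π, ∫ θ in -π..π, ρ² sin φ · f (…)`.
[cite: Hurley1980, Sect. 5.8 Ex. 8.6] -/
theorem setIntegral_ball_eq_iterated {R : ℝ} (hR : 0 ≤ R) {f : (ℝ × ℝ) × ℝ → ℝ}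
    (hf : IntegrableOn f {p : (ℝ × ℝ) × ℝ | p.1.1 ^ 2 + p.1.2 ^ 2 + p.2 ^ 2 ≤ R ^ 2}) :
    ∫ p in {p : (ℝ × ℝ) × ℝ | p.1.1 ^ 2 + p.1.2 ^ 2 + p.2 ^ 2 ≤ R ^ 2}, f p =
      ∫ ρ in (0 : ℝ)..R, ∫ φ in (0 : ℝ)..π, ∫ θ in (-π)..π,
        ρ ^ 2 * sin φ * f ((ρ * sin φ * cos θ, ρ * sin φ * sin θ), ρ * cos φ) := by
  rw [← sphericalBox_eq_ball hR] at hf ⊢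
  exact setIntegral_sphericalBox_eq_iterated le_rfl hR le_rfl pi_pos.le le_rfl le_rfl (by linarith [pi_pos])
    le_rfl hf

/-- **The ball, continuous case**: no side condition. [cite: Hurley1980, Sect. 5.8 Ex. 8.6] -/
theorem setIntegral_ball_eq_iterated_of_continuous {R : ℝ} (hR : 0 ≤ R) {f : (ℝ × ℝ) × ℝ → ℝ}
    (hf : Continuous f) :
    ∫ p in {p : (ℝ × ℝ) × ℝ | p.1.1 ^ 2 + p.1.2 ^ 2 + p.2 ^ 2 ≤ R ^ 2}, f p =
      ∫ ρ in (0 : ℝ)..R, ∫ φ in (0 : ℝ)..π, ∫ θ in (-π)..π,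
        ρ ^ 2 * sin φ * f ((ρ * sin φ * cos θ, ρ * sin φ * sin θ), ρ * cos φ) := by
  rw [← sphericalBox_eq_ball hR]
  exact setIntegral_sphericalBox_eq_iterated_of_continuous le_rfl hR le_rfl pi_pos.le le_rfl le_rfl
    (by linarith [pi_pos]) le_rfl hf

/-- **The spherical shell**: for `0 ≤ R₁ ≤ R₂` and `f` integrable on `{R₁² ≤ x² + y² + z² ≤ R₂²}`,
`∫ p in shell, f p = ∫ ρ in R₁..R₂, ∫ φ in 0..π, ∫ θ in -π..π, ρ² sin φ · f (…)`. [cite: Hurley1980, Sect. 5.8 Thm. 8.5] -/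
theorem setIntegral_shell_eq_iterated {R₁ R₂ : ℝ} (hR₁ : 0 ≤ R₁) (hR : R₁ ≤ R₂) {f : (ℝ × ℝ) × ℝ → ℝ}
    (hf : IntegrableOn f {p : (ℝ × ℝ) × ℝ |
      R₁ ^ 2 ≤ p.1.1 ^ 2 + p.1.2 ^ 2 + p.2 ^ 2 ∧ p.1.1 ^ 2 + p.1.2 ^ 2 + p.2 ^ 2 ≤ R₂ ^ 2}) :
    ∫ p in {p : (ℝ × ℝ) × ℝ | R₁ ^ 2 ≤ p.1.1 ^ 2 + p.1.2 ^ 2 + p.2 ^ 2 ∧ p.1.1 ^ 2 + p.1.2 ^ 2 + p.2 ^ 2 ≤ R₂ ^ 2},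
        f p =
      ∫ ρ in R₁..R₂, ∫ φ in (0 : ℝ)..π, ∫ θ in (-π)..π,
        ρ ^ 2 * sin φ * f ((ρ * sin φ * cos θ, ρ * sin φ * sin θ), ρ * cos φ) := by
  rw [← sphericalBox_eq_shell hR₁ (hR₁.trans hR)] at hf ⊢
  exact setIntegral_sphericalBox_eq_iterated hR₁ hR le_rfl pi_pos.le le_rfl le_rfl (by linarith [pi_pos]) le_rfl hf

end Literature.MeasureTheory.Integral
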